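import Summits.NavierStokesRegularity.NavierStokesRegularity.Theorems.ExtremiserTransienceNearExtremalTransienceExtremiserLiouvilleConstantSpeedL2FluxEstimate
import Summits.NavierStokesRegularity.NavierStokesRegularity.Theorems.ExtremiserTransienceNearExtremalTransienceExtremiserLiouvilleDensityCorrector
import HarnessLib

/-!
# Crux `ExtremiserTransience.NearExtremalTransience` (stmt-NavierStokesRegularity-21883), line `extremiser_liouville`,
# stub K1b — ENERGY-FLUX INVARIANCE of the residue object (the plane energies of `w − c` are translation invariant)

`--supports stmt-NavierStokesRegularity-21883` (helper).  Author: prover seat `ns-el-k1b` (g5).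

The K1b residue object is a constant-speed analytic extended extremiser `w` with far field `c` (`‖w‖ ≡ M = ‖c‖`, `div w = 0`,
`w → c`); g3 proved `∫‖w − c‖² = ∞` and g4 that `w − c` is not `O(|x|^{-a})` for any `a > 1`, while an explicit example shows
that the soft structure allows an exact `|x|⁻¹` tail.  This file isolates the KINEMATIC reason behind both Liouville theorems.
With `c = (0,0,c₂)`, `V := w − c` satisfies `V₂ = −‖V‖²/(2c₂)` (constant speed), so the flux of `V` through a horizontal plane
is `−(2c₂)⁻¹ ×` the PLANE ENERGY `E(z) = ∫_{ℝ²} ‖V(x_h, z)‖² dx_h`, and `div V = 0` makes this flux independent of the plane as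
soon as the lateral leak vanishes.  Rigorous form — testing `div V = 0` against the UNWEIGHTED axial test function
`θ(x₂) · χ_ρ(x − x₂e₂)` (no `arctan` weight, unlike g2/g3):

* `abs_integral_deriv_axialTest_cutoff_mul_sq_le` : for `θ ∈ C¹` supported in `(−T, T)` and `‖V‖² ∈ L¹` of the slab
  `{|x₂| ≤ T}`: `|∫ θ′(x₂) χ_ρ ‖V‖²| ≤ K · (η · ∫_{‖x‖ ≥ ρ, |x₂| ≤ T} ‖V‖² + T/η)` for all `ρ, η > 0`;
* `integral_deriv_axialTest_mul_sq_eq_zero` : **`∫ θ′(x₂) ‖V x‖² dx = 0`** (`ρ → ∞`, then `η → ∞`);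
* `integral_deriv_smoothTransition_mul_sq_eq` : with `H = Real.smoothTransition`, the WINDOW ENERGIES
  `E(s) := ∫ H′(x₂ − s) ‖V x‖² dx` (a unit-mass average of the plane energies over `s ≤ x₂ ≤ s + 1`) satisfy
  **`E(s) = E(t)` whenever `‖V‖² ∈ L¹({|x₂| ≤ T})` with `|s| + 1, |t| + 1 ≤ T`** — the plane energy, i.e. the volume flux of
  `w − c` through the planes orthogonal to the far field, is a CONSTANT OF THE MOTION along the far-field axis.

CONSEQUENCE for K1b (see `…ConstantSpeedEnergyFluxLiouville`): either `‖w − c‖² ∉ L¹` of some bounded slab `{a < x₂ < b}`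
("flat" tail), or the residue object is a BI-INFINITE JET: every unit window of horizontal planes — far above AND far below the
core — carries the same energy `E₀ > 0` (`E₀ = 0` forces `w ≡ c`, contradicting `Z > 0`).  g3's `L²` Liouville (`∫E = ‖V‖₂²`)
and g4's decay-gap Liouville (`E(s) → 0`) are immediate corollaries, as are new ones (horizontal majorant + far field).

WHAT THIS IS NOT: K1b is NOT proved; the jet alternative is not excluded here; nothing here proves NS regularity. [folklore]
-/

noncomputable section

open Set Filter Topology MeasureTheory Metric Function
open scoped ENNReal NNReal Topology InnerProductSpace RealInnerProductSpace ContDiff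
open Literature.Analysis.FluidPDE Literature.Analysis

namespace Summit.NavierStokesRegularity.NavierStokesRegularity.Theorems

-- the problem directory repeats the summit name (`NavierStokesRegularity/NavierStokesRegularity`)
set_option linter.dupNamespace false

namespace ExtremiserLiouville

variable {V : EuclideanSpace ℝ (Fin 3) → EuclideanSpace ℝ (Fin 3)} {c : EuclideanSpace ℝ (Fin 3)}

/-! ## Small tools -/

/-- A `C¹` function of one variable vanishing on `T ≤ |s|` has its derivative vanishing there too. [folklore] -/
theorem deriv_eq_zero_of_eq_zero_of_le_abs {θ : ℝ → ℝ} {T : ℝ} (hθT : ∀ s, T ≤ |s| → θ s = 0) {s : ℝ} (hs : T < |s|) :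
    deriv θ s = 0 := by
  have hev : θ =ᶠ[𝓝 s] fun _ => (0 : ℝ) := by
    filter_upwards [(isOpen_lt continuous_const continuous_abs).mem_nhds hs] with y hy
    exact hθT y (le_of_lt hy)
  rw [hev.deriv_eq, deriv_const]

/-- A `C¹` function supported in `[-T, T]` and its derivative are bounded, and the derivative is supported in `[-T, T]`. [folklore] -/
theorem exists_bound_axialTest {θ : ℝ → ℝ} (hθ : ContDiff ℝ 1 θ) {T : ℝ} (hθT : ∀ s, T ≤ |s| → θ s = 0) :
    ∃ A : ℝ, 0 ≤ A ∧ (∀ s, |θ s| ≤ A) ∧ (∀ s, |deriv θ s| ≤ A) ∧ ∀ s, deriv θ s ≠ 0 → |s| ≤ T := by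
  have hθc : HasCompactSupport θ := by
    refine HasCompactSupport.intro (isCompact_Icc (a := -|T|) (b := |T|)) fun s hs => hθT s ?_
    rw [mem_Icc, not_and_or, not_le, not_le] at hs
    have hlt : |T| < |s| := by
      rcases hs with h | h
      · calc |T| < -s := by linarith
          _ ≤ |s| := neg_le_abs s
      · exact h.trans_le (le_abs_self s)
    exact (le_abs_self T).trans hlt.le
  obtain ⟨A₁, hA₁⟩ := hθ.continuous.bounded_above_of_compact_support hθc
  obtain ⟨A₂, hA₂⟩ := (hθ.continuous_deriv le_rfl).bounded_above_of_compact_support hθc.deriv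
  refine ⟨max (max A₁ A₂) 0, le_max_right _ _, fun s => ?_, fun s => ?_, fun s hs => ?_⟩
  · rw [← Real.norm_eq_abs]; exact (hA₁ s).trans ((le_max_left _ _).trans (le_max_left _ _))
  · rw [← Real.norm_eq_abs]; exact (hA₂ s).trans ((le_max_right _ _).trans (le_max_left _ _))
  · by_contra h
    exact hs (deriv_eq_zero_of_eq_zero_of_le_abs hθT (not_le.1 h))

/-! ## The estimate with the axial test `θ(x₂)` and the transverse cut-off `χ_ρ` -/

/-- **Main estimate.**  For `V ∈ C¹` divergence free with `⟪V, c⟫ = −‖V‖²/2`, `c₀ = c₁ = 0 ≠ c₂`, `θ ∈ C¹(ℝ)` vanishing on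
`T ≤ |s|`, and `‖V‖² ∈ L¹({|x₂| ≤ T})`: for all `ρ, η > 0`,
`|∫ θ′(x₂) χ_ρ(x − x₂e₂) ‖V x‖² dx| ≤ K (η ∫ 𝟙_{ρ ≤ ‖x‖} 𝟙_{|x₂| ≤ T} ‖V‖² + T/η)`, `K` depending only on `θ, c₂` and the
cut-off profile (the lateral leak through the cylinder `‖x_h‖ ∼ ρ`, `|x₂| ≤ T`, by AM–GM against its volume). [folklore] -/
theorem abs_integral_deriv_axialTest_cutoff_mul_sq_le (hV : ContDiff ℝ 1 V) (hdiv : VectorCalculus.IsDivFree V)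
    (hVc : ∀ x, ⟪V x, c⟫ = -(‖V x‖ ^ 2 / 2)) (hc0 : c 0 = 0) (hc1 : c 1 = 0) (hc2 : c 2 ≠ 0)
    {θ : ℝ → ℝ} (hθ : ContDiff ℝ 1 θ) {T : ℝ} (hT : 0 < T) (hθT : ∀ s, T ≤ |s| → θ s = 0)
    (hL2 : Integrable (fun x => {x : EuclideanSpace ℝ (Fin 3) | |x 2| ≤ T}.indicator (fun x => ‖V x‖ ^ 2) x) volume) :
    ∃ K : ℝ, 0 ≤ K ∧ ∀ ρ η : ℝ, 0 < ρ → 0 < η →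
      |∫ x, deriv θ (x 2) * cutoff ρ (x - (x 2) • EuclideanSpace.single (2 : Fin 3) (1 : ℝ)) * ‖V x‖ ^ 2| ≤
        K * (η * (∫ x in {x : EuclideanSpace ℝ (Fin 3) | ρ ≤ ‖x‖},
              {x : EuclideanSpace ℝ (Fin 3) | |x 2| ≤ T}.indicator (fun x => ‖V x‖ ^ 2) x) + T / η) := by
  obtain ⟨C₂, hC₂, hC2⟩ := exists_norm_fderiv_cutoff_le (E := EuclideanSpace ℝ (Fin 3))
  obtain ⟨A, hA, hθA, -, -⟩ := exists_bound_axialTest hθ hθT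
  obtain ⟨P, hP⟩ := exists_transverseProj
  refine ⟨2 * |c 2| * A * C₂ * 16, by positivity, fun ρ η hρ hη => ?_⟩
  set e₂ : EuclideanSpace ℝ (Fin 3) := EuclideanSpace.single (2 : Fin 3) (1 : ℝ) with he₂
  set SL : Set (EuclideanSpace ℝ (Fin 3)) := {x | |x 2| ≤ T} with hSL
  set F : EuclideanSpace ℝ (Fin 3) → ℝ := fun x => SL.indicator (fun x => ‖V x‖ ^ 2) x with hF
  -- the two factors of the test function
  set k : EuclideanSpace ℝ (Fin 3) → ℝ := fun x => θ (x 2) with hkdef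
  set χ : EuclideanSpace ℝ (Fin 3) → ℝ := fun x => cutoff ρ (x - (x 2) • e₂) with hχdef
  have hk2 : k = fun x => θ ((EuclideanSpace.proj (2 : Fin 3) : EuclideanSpace ℝ (Fin 3) →L[ℝ] ℝ) x) := rfl
  have hχP : χ = fun x => cutoff ρ (P x) := funext fun x => by rw [hχdef, hP]
  have hk : ContDiff ℝ 1 k := by
    rw [hk2]; exact hθ.comp (EuclideanSpace.proj (2 : Fin 3) : EuclideanSpace ℝ (Fin 3) →L[ℝ] ℝ).contDiff
  have hχ : ContDiff ℝ 1 χ := by rw [hχP]; exact (contDiff_cutoff ρ).comp P.contDiff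
  have hK : ContDiff ℝ 1 fun x => k x * χ x := hk.mul hχ
  have hχ01 : ∀ x, 0 ≤ χ x ∧ χ x ≤ 1 := fun x => ⟨cutoff_nonneg _ _, cutoff_le_one _ _⟩
  have hk0 : ∀ x : EuclideanSpace ℝ (Fin 3), T ≤ |x 2| → k x = 0 := fun x hx => hθT _ hx
  have hχ0 : ∀ x : EuclideanSpace ℝ (Fin 3), 2 * ρ < ‖x - (x 2) • e₂‖ → χ x = 0 := fun x hx => by
    rw [hχdef]; exact cutoff_eq_zero hρ hx.le
  -- the box containing the support of everything
  set BOX : Set (EuclideanSpace ℝ (Fin 3)) := {x | |x 0| ≤ 2 * ρ ∧ |x 1| ≤ 2 * ρ ∧ |x 2| ≤ T} with hBOX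
  have hPcoord := transverseProj_apply
  have hBOXbdd : BOX ⊆ closedBall (0 : EuclideanSpace ℝ (Fin 3)) (2 * ρ + 2 * ρ + T) := by
    intro x hx
    rw [mem_closedBall_zero_iff]
    obtain ⟨h0, h1, h2⟩ := hx
    have hsq : ‖x‖ ^ 2 = |x 0| ^ 2 + |x 1| ^ 2 + |x 2| ^ 2 := by
      rw [EuclideanSpace.real_norm_sq_eq, Fin.sum_univ_three, sq_abs, sq_abs, sq_abs]
    nlinarith [abs_nonneg (x 0), abs_nonneg (x 1), abs_nonneg (x 2), norm_nonneg x, hρ, hT]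
  have hsuppBOX : ∀ x, k x * χ x ≠ 0 → x ∈ BOX := by
    intro x hx
    have hkx : k x ≠ 0 := left_ne_zero_of_mul hx
    have hχx : χ x ≠ 0 := right_ne_zero_of_mul hx
    have h2 : |x 2| ≤ T := by by_contra h; exact hkx (hk0 x (not_le.1 h).le)
    have h01 : ‖x - (x 2) • e₂‖ ≤ 2 * ρ := by by_contra h; exact hχx (hχ0 x (not_le.1 h))
    obtain ⟨q0, q1, -⟩ := hPcoord x
    refine ⟨?_, ?_, h2⟩
    · have := PiLp.norm_apply_le (x - (x 2) • e₂) (0 : Fin 3)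
      rw [Real.norm_eq_abs, q0] at this; exact this.trans h01
    · have := PiLp.norm_apply_le (x - (x 2) • e₂) (1 : Fin 3)
      rw [Real.norm_eq_abs, q1] at this; exact this.trans h01
  have hKc : HasCompactSupport fun x => k x * χ x :=
    HasCompactSupport.intro (isCompact_closedBall (0 : EuclideanSpace ℝ (Fin 3)) (2 * ρ + 2 * ρ + T))
      fun x hx => by
        by_contra h
        exact hx (hBOXbdd (hsuppBOX x h))
  -- the tested identity `∫ D(kχ)(V) = 0`
  have hid := integral_fderiv_apply_eq_zero_of_isDivFree hK hV hdiv (hKc.smul_right (f' := V))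
  -- the axial component of `V` is quadratic
  have hVx2 : ∀ x, V x 2 = -(‖V x‖ ^ 2 / 2) / c 2 := fun x => by
    have h := hVc x
    have hinner : ⟪V x, c⟫ = V x 2 * c 2 := by
      simp only [PiLp.inner_apply, RCLike.inner_apply, conj_trivial, Fin.sum_univ_three, hc0, hc1]
      ring
    rw [hinner] at h
    field_simp
    linarith
  -- the derivative of the product along `V`
  have hDk : ∀ x, fderiv ℝ k x (V x) = deriv θ (x 2) * V x 2 := fun x => by
    have h : HasFDerivAt k ((fderiv ℝ θ (x 2)).comp
        (EuclideanSpace.proj (2 : Fin 3) : EuclideanSpace ℝ (Fin 3) →L[ℝ] ℝ)) x := by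
      rw [hk2]
      exact ((hθ.differentiable one_ne_zero) _).hasFDerivAt.comp x
        (EuclideanSpace.proj (2 : Fin 3) : EuclideanSpace ℝ (Fin 3) →L[ℝ] ℝ).hasFDerivAt
    rw [h.fderiv, ContinuousLinearMap.comp_apply]
    show fderiv ℝ θ (x 2) (V x 2) = _
    rw [fderiv_eq_smul_deriv, smul_eq_mul, mul_comm]
  have hDχ : ∀ x, fderiv ℝ χ x (V x) = fderiv ℝ (cutoff ρ) (P x) (P (V x)) := fun x => by
    have h : HasFDerivAt χ ((fderiv ℝ (cutoff ρ) (P x)).comp P) x := by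
      rw [hχP]
      exact (((contDiff_cutoff (n := 1) ρ).differentiable one_ne_zero) _).hasFDerivAt.comp x P.hasFDerivAt
    rw [h.fderiv]
    rfl
  have hDK : ∀ x, fderiv ℝ (fun x => k x * χ x) x (V x) =
      -(1 / (2 * c 2)) * (deriv θ (x 2) * χ x * ‖V x‖ ^ 2) + k x * fderiv ℝ (cutoff ρ) (P x) (P (V x)) := by
    intro x
    have hk' : HasFDerivAt k (fderiv ℝ k x) x := ((hk.differentiable one_ne_zero) x).hasFDerivAt
    have hχ' : HasFDerivAt χ (fderiv ℝ χ x) x := ((hχ.differentiable one_ne_zero) x).hasFDerivAt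
    have hm : HasFDerivAt (fun x => k x * χ x) (k x • fderiv ℝ χ x + χ x • fderiv ℝ k x) x := hk'.mul hχ'
    rw [hm.fderiv]
    show k x • fderiv ℝ χ x (V x) + χ x • fderiv ℝ k x (V x) = _
    rw [smul_eq_mul, smul_eq_mul, hDk, hDχ, hVx2]
    field_simp
    ring
  -- split the tested identity: main term = leak term
  have hmain_int : Integrable (fun x => deriv θ (x 2) * χ x * ‖V x‖ ^ 2) volume := by
    refine Continuous.integrable_of_hasCompactSupport ?_ ?_
    · exact (((hθ.continuous_deriv le_rfl).comp (PiLp.continuous_apply 2 _ (2 : Fin 3))).mul hχ.continuous).mul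
        (hV.continuous.norm.pow 2)
    · refine HasCompactSupport.intro (isCompact_closedBall (0 : EuclideanSpace ℝ (Fin 3)) (2 * ρ + 2 * ρ + T))
        fun x hx => ?_
      obtain ⟨-, -, -, -, hθsupp⟩ := exists_bound_axialTest hθ hθT
      by_contra h
      have hd : deriv θ (x 2) ≠ 0 := left_ne_zero_of_mul (left_ne_zero_of_mul h)
      have hχx : χ x ≠ 0 := right_ne_zero_of_mul (left_ne_zero_of_mul h)
      have h2 : |x 2| ≤ T := hθsupp _ hd
      have h01 : ‖x - (x 2) • e₂‖ ≤ 2 * ρ := by by_contra h'; exact hχx (hχ0 x (not_le.1 h'))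
      obtain ⟨q0, q1, -⟩ := hPcoord x
      refine hx (hBOXbdd ⟨?_, ?_, h2⟩)
      · have := PiLp.norm_apply_le (x - (x 2) • e₂) (0 : Fin 3)
        rw [Real.norm_eq_abs, q0] at this; exact this.trans h01
      · have := PiLp.norm_apply_le (x - (x 2) • e₂) (1 : Fin 3)
        rw [Real.norm_eq_abs, q1] at this; exact this.trans h01
  have hleak_int : Integrable (fun x => k x * fderiv ℝ (cutoff ρ) (P x) (P (V x))) volume := by
    refine Continuous.integrable_of_hasCompactSupport ?_ ?_
    · have hc1 : Continuous fun x => fderiv ℝ (cutoff ρ) (P x) := ((contDiff_cutoff (n := 1) ρ).continuous_fderiv one_ne_zero).comp P.continuous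
      exact hk.continuous.mul (hc1.clm_apply (P.continuous.comp hV.continuous))
    · refine HasCompactSupport.intro (isCompact_closedBall (0 : EuclideanSpace ℝ (Fin 3)) (2 * ρ + 2 * ρ + T))
        fun x hx => ?_
      by_contra h
      have hkx : k x ≠ 0 := left_ne_zero_of_mul h
      have hDx : fderiv ℝ (cutoff ρ) (P x) (P (V x)) ≠ 0 := right_ne_zero_of_mul h
      have h2 : |x 2| ≤ T := by by_contra h'; exact hkx (hk0 x (not_le.1 h').le)
      have hann : ρ ≤ ‖P x‖ ∧ ‖P x‖ ≤ 2 * ρ := by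
        by_contra h'
        exact hDx (by rw [fderiv_cutoff_eq_zero_of_notMem hρ h']; rfl)
      obtain ⟨q0, q1, -⟩ := hPcoord x
      have hPx : P x = x - (x 2) • e₂ := hP x
      refine hx (hBOXbdd ⟨?_, ?_, h2⟩)
      · have := PiLp.norm_apply_le (x - (x 2) • e₂) (0 : Fin 3)
        rw [Real.norm_eq_abs, q0, ← hPx] at this; exact this.trans hann.2
      · have := PiLp.norm_apply_le (x - (x 2) • e₂) (1 : Fin 3)
        rw [Real.norm_eq_abs, q1, ← hPx] at this; exact this.trans hann.2
  have hsplit : (1 / (2 * c 2)) * (∫ x, deriv θ (x 2) * χ x * ‖V x‖ ^ 2) =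
      ∫ x, k x * fderiv ℝ (cutoff ρ) (P x) (P (V x)) := by
    have h := hid
    simp_rw [hDK] at h
    rw [integral_add (hmain_int.const_mul _) hleak_int, integral_const_mul] at h
    linarith
  -- pointwise bound of the leak integrand (AM–GM on the annulus-slab, against the volume of the box)
  set bound : EuclideanSpace ℝ (Fin 3) → ℝ := fun x =>
    (A * C₂ * (η / 2)) * {x : EuclideanSpace ℝ (Fin 3) | ρ ≤ ‖x‖}.indicator F x +
      (A * C₂ * (1 / (2 * η * ρ ^ 2))) * BOX.indicator (fun _ => (1 : ℝ)) x with hbound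
  have hP_norm : ∀ v : EuclideanSpace ℝ (Fin 3), ‖P v‖ ≤ ‖v‖ := fun v => by rw [hP]; exact norm_transverseProj_le v
  have hptw : ∀ x, ‖k x * fderiv ℝ (cutoff ρ) (P x) (P (V x))‖ ≤ bound x := by
    intro x
    rw [Real.norm_eq_abs]
    have hbound0 : 0 ≤ bound x := by
      simp only [hbound]
      refine add_nonneg (mul_nonneg (by positivity) (indicator_nonneg (fun y _ => ?_) _))
        (mul_nonneg (by positivity) (indicator_nonneg (fun _ _ => zero_le_one) _))
      simp only [hF]
      exact indicator_nonneg (fun _ _ => sq_nonneg _) _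
    by_cases hann : ρ ≤ ‖P x‖ ∧ ‖P x‖ ≤ 2 * ρ
    · by_cases hkx : k x = 0
      · rw [hkx, zero_mul, abs_zero]; exact hbound0
      · -- `x ∈ BOX`, `‖x‖ ≥ ρ`, `|x 2| ≤ T`
        have h2 : |x 2| ≤ T := by by_contra h; exact hkx (hk0 x (not_le.1 h).le)
        have hxfar : x ∈ {x : EuclideanSpace ℝ (Fin 3) | ρ ≤ ‖x‖} := hann.1.trans (hP_norm x)
        have hxSL : x ∈ SL := h2
        have hxBOX : x ∈ BOX := by
          obtain ⟨q0, q1, -⟩ := hPcoord x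
          have hPx : P x = x - (x 2) • e₂ := hP x
          refine ⟨?_, ?_, h2⟩
          · have := PiLp.norm_apply_le (x - (x 2) • e₂) (0 : Fin 3)
            rw [Real.norm_eq_abs, q0, ← hPx] at this; exact this.trans hann.2
          · have := PiLp.norm_apply_le (x - (x 2) • e₂) (1 : Fin 3)
            rw [Real.norm_eq_abs, q1, ← hPx] at this; exact this.trans hann.2
        have hFx : F x = ‖V x‖ ^ 2 := by simp only [hF, indicator_of_mem hxSL]
        simp only [hbound]
        rw [indicator_of_mem hxfar, indicator_of_mem hxBOX, hFx, abs_mul]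
        have h1 : |fderiv ℝ (cutoff ρ) (P x) (P (V x))| ≤ C₂ / ρ * ‖V x‖ := by
          rw [← Real.norm_eq_abs]
          calc ‖fderiv ℝ (cutoff ρ) (P x) (P (V x))‖ ≤ ‖fderiv ℝ (cutoff ρ) (P x)‖ * ‖P (V x)‖ :=
                (fderiv ℝ (cutoff ρ) (P x)).le_opNorm _
            _ ≤ (C₂ / ρ) * ‖V x‖ := mul_le_mul (hC2 ρ hρ (P x)) (hP_norm (V x)) (norm_nonneg _) (by positivity)
        have hamgm : C₂ / ρ * ‖V x‖ ≤ C₂ * (η / 2 * ‖V x‖ ^ 2 + 1 / (2 * η * ρ ^ 2)) := by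
          have hkey : ‖V x‖ / ρ ≤ η / 2 * ‖V x‖ ^ 2 + 1 / (2 * η * ρ ^ 2) := by
            have heq : η / 2 * ‖V x‖ ^ 2 + 1 / (2 * η * ρ ^ 2) - ‖V x‖ / ρ =
                (η * ρ * ‖V x‖ - 1) ^ 2 / (2 * η * ρ ^ 2) := by
              field_simp
              ring
            have hnn : 0 ≤ (η * ρ * ‖V x‖ - 1) ^ 2 / (2 * η * ρ ^ 2) := by positivity
            linarith
          calc C₂ / ρ * ‖V x‖ = C₂ * (‖V x‖ / ρ) := by ring
            _ ≤ C₂ * (η / 2 * ‖V x‖ ^ 2 + 1 / (2 * η * ρ ^ 2)) := mul_le_mul_of_nonneg_left hkey hC₂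
        calc |k x| * |fderiv ℝ (cutoff ρ) (P x) (P (V x))| ≤ A * (C₂ / ρ * ‖V x‖) :=
              mul_le_mul (hθA _) h1 (abs_nonneg _) hA
          _ ≤ A * (C₂ * (η / 2 * ‖V x‖ ^ 2 + 1 / (2 * η * ρ ^ 2))) := mul_le_mul_of_nonneg_left hamgm hA
          _ = A * C₂ * (η / 2) * ‖V x‖ ^ 2 + A * C₂ * (1 / (2 * η * ρ ^ 2)) * 1 := by ring
    · have h0 : fderiv ℝ (cutoff ρ) (P x) (P (V x)) = 0 := by
        rw [fderiv_cutoff_eq_zero_of_notMem hρ hann]; rfl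
      rw [h0, mul_zero, abs_zero]
      exact hbound0
  -- the box is measurable with volume `32 ρ² T`
  have hBOXmeas : MeasurableSet BOX := by
    have : BOX = {x | |x 0| ≤ 2 * ρ} ∩ {x | |x 1| ≤ 2 * ρ} ∩ {x | |x 2| ≤ T} := by
      ext x; simp [hBOX, and_assoc]
    rw [this]
    have hc : ∀ i : Fin 3, Continuous fun x : EuclideanSpace ℝ (Fin 3) => |x i| := fun i =>
      (continuous_apply i |>.comp (PiLp.continuous_ofLp 2 _)).abs
    exact ((isClosed_le (hc 0) continuous_const).measurableSet.inter (isClosed_le (hc 1) continuous_const).measurableSet).inter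
      (isClosed_le (hc 2) continuous_const).measurableSet
  have hBOXfin : volume BOX < ⊤ :=
    (measure_mono hBOXbdd).trans_lt (isCompact_closedBall _ _).measure_lt_top
  have hBOXreal : (volume BOX).toReal = 32 * ρ ^ 2 * T := by
    set r : Fin 3 → ℝ := ![2 * ρ, 2 * ρ, T] with hr
    have hBOXeq : BOX = (WithLp.ofLp : EuclideanSpace ℝ (Fin 3) → (Fin 3 → ℝ)) ⁻¹' Set.Icc (-r) r := by
      ext x
      simp only [hBOX, mem_setOf_eq, mem_preimage, Set.mem_Icc, Pi.le_def, Pi.neg_apply, abs_le]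
      constructor
      · rintro ⟨h0, h1, h2⟩
        refine ⟨fun i => ?_, fun i => ?_⟩ <;> fin_cases i <;> simp [hr] <;> linarith [h0.1, h0.2, h1.1, h1.2, h2.1, h2.2]
      · rintro ⟨hl, hu⟩
        have l0 := hl 0; have l1 := hl 1; have l2 := hl 2; have u0 := hu 0; have u1 := hu 1; have u2 := hu 2
        simp [hr] at l0 l1 l2 u0 u1 u2
        exact ⟨⟨l0, u0⟩, ⟨l1, u1⟩, ⟨l2, u2⟩⟩
    have hrr : -r ≤ r := fun i => by fin_cases i <;> simp [hr] <;> linarith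
    rw [hBOXeq, (PiLp.volume_preserving_ofLp (Fin 3)).measure_preimage measurableSet_Icc.nullMeasurableSet,
      Real.volume_Icc_pi_toReal hrr, Fin.prod_univ_three]
    simp [hr]
    ring
  -- integrability of the bound and its integral
  have hfar_meas : MeasurableSet {x : EuclideanSpace ℝ (Fin 3) | ρ ≤ ‖x‖} :=
    (isClosed_le continuous_const continuous_norm).measurableSet
  have hI1 : Integrable (fun x => {x : EuclideanSpace ℝ (Fin 3) | ρ ≤ ‖x‖}.indicator F x) volume :=
    hL2.indicator hfar_meas
  have hI2 : Integrable (fun x => BOX.indicator (fun _ => (1 : ℝ)) x) volume := by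
    rw [integrable_indicator_iff hBOXmeas]
    exact integrableOn_const hBOXfin.ne
  have hbound_int : Integrable bound volume := by
    simp only [hbound]
    exact (hI1.const_mul _).add (hI2.const_mul _)
  have hmain := norm_integral_le_of_norm_le hbound_int (Eventually.of_forall hptw)
  have hbound_val : ∫ x, bound x =
      (A * C₂ * (η / 2)) * (∫ x in {x : EuclideanSpace ℝ (Fin 3) | ρ ≤ ‖x‖}, F x) +
        (A * C₂ * (1 / (2 * η * ρ ^ 2))) * (32 * ρ ^ 2 * T) := by
    have hI1' : Integrable (fun x => (A * C₂ * (η / 2)) * {x : EuclideanSpace ℝ (Fin 3) | ρ ≤ ‖x‖}.indicator F x) volume :=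
      hI1.const_mul _
    have hI2' : Integrable (fun x => (A * C₂ * (1 / (2 * η * ρ ^ 2))) * BOX.indicator (fun _ => (1 : ℝ)) x) volume :=
      hI2.const_mul _
    simp only [hbound]
    rw [integral_add hI1' hI2', integral_const_mul, integral_const_mul,
      integral_indicator hfar_meas, integral_indicator hBOXmeas, setIntegral_const, smul_eq_mul, mul_one,
      measureReal_def, hBOXreal]
  have hF0 : 0 ≤ ∫ x in {x : EuclideanSpace ℝ (Fin 3) | ρ ≤ ‖x‖}, F x :=
    setIntegral_nonneg hfar_meas fun x _ => by simp only [hF]; exact indicator_nonneg (fun _ _ => sq_nonneg _) _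
  have habs : |∫ x, k x * fderiv ℝ (cutoff ρ) (P x) (P (V x))| ≤ ∫ x, bound x := by
    simpa only [Real.norm_eq_abs] using hmain
  rw [hbound_val] at habs
  have e1 : (A * C₂ * (1 / (2 * η * ρ ^ 2))) * (32 * ρ ^ 2 * T) = A * C₂ * 16 * (T / η) := by
    field_simp
    ring
  rw [e1] at habs
  -- assemble: `|main| = |2 c₂| · |leak|`
  have hc2pos : 0 < |c 2| := abs_pos.2 hc2
  have hmain_eq : (∫ x, deriv θ (x 2) * χ x * ‖V x‖ ^ 2) = (2 * c 2) * ∫ x, k x * fderiv ℝ (cutoff ρ) (P x) (P (V x)) := by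
    rw [← hsplit]
    field_simp
  have hχx : ∀ x, cutoff ρ (x - (x 2) • e₂) = χ x := fun x => rfl
  simp_rw [hχx]
  rw [hmain_eq, abs_mul, abs_mul, abs_two]
  calc 2 * |c 2| * |∫ x, k x * fderiv ℝ (cutoff ρ) (P x) (P (V x))|
      ≤ 2 * |c 2| * ((A * C₂ * (η / 2)) * (∫ x in {x : EuclideanSpace ℝ (Fin 3) | ρ ≤ ‖x‖}, F x) + A * C₂ * 16 * (T / η)) :=
        mul_le_mul_of_nonneg_left habs (by positivity)
    _ ≤ 2 * |c 2| * A * C₂ * 16 * (η * (∫ x in {x : EuclideanSpace ℝ (Fin 3) | ρ ≤ ‖x‖}, F x) + T / η) := by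
        have h1 : (A * C₂ * (η / 2)) * (∫ x in {x : EuclideanSpace ℝ (Fin 3) | ρ ≤ ‖x‖}, F x) ≤
            A * C₂ * 16 * (η * ∫ x in {x : EuclideanSpace ℝ (Fin 3) | ρ ≤ ‖x‖}, F x) := by
          have : 0 ≤ A * C₂ * η * ∫ x in {x : EuclideanSpace ℝ (Fin 3) | ρ ≤ ‖x‖}, F x := by positivity
          nlinarith
        nlinarith [h1, hc2pos, hF0, hA, hC₂, hη.le, hT.le]

end ExtremiserLiouville

end Summit.NavierStokesRegularity.NavierStokesRegularity.Theorems

end
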